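import Summits.MatrixMultiplication.MatrixMultiplication.Theorems.GradedDesignFamily.Negative.SubfieldCellNineRowThreeFifteenSound
import Summits.MatrixMultiplication.MatrixMultiplication.Theorems.GradedDesignFamily.Negative.SubfieldCellNineRowThreeFifteenCertB
import Summits.MatrixMultiplication.MatrixMultiplication.Theorems.GradedDesignFamily.Negative.SubfieldCellNineRowThreeFifteenCertC
import Summits.MatrixMultiplication.MatrixMultiplication.Theorems.GradedDesignFamily.Negative.SubfieldCellNineRowThreeFifteenCertD
import Summits.MatrixMultiplication.MatrixMultiplication.Theorems.GradedDesignFamily.Negative.SubfieldCellNineRowThreeFifteenCertE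
import Summits.MatrixMultiplication.MatrixMultiplication.Theorems.GradedDesignFamily.Negative.SubfieldCellNineRowTwoAny

/-!
# Subfield cell `GL₂(𝔽₉) ⊃ SL₂(𝔽₃)` at level one — X-b: `|Y| ≥ 3 ⇒ |Z| ≤ 15`

**Honest framing.** VALUE = a DECIDABLE VERDICT on one more instance of ONE finite cell of ONE
skeleton line (`quadratic_extension_level_one_cell`, stub S3 `stub_subfieldCell`, crux
`GradedDesignFamily`, route `LevelGradedCohnUmans`): the `(3,16)` instance of the `q = 3` cell is
FALSE.  It is **not** progress on `Summit.MatrixMultiplication` and does **not** refute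
`stub_subfieldCell` (an asymptotic statement over all `q`).

## Result

`subfieldCell_nine_no_3x16`: for all `(k, K', φ)` with `|k| = 3`, `|K'| = 9`, `φ : SL₂(k) ↪ GL₂(K')`
there is no level-one separated pair `(Y, Z)` (S3's separation clause verbatim) with `|Y| ≥ 3`
and `|Z| ≥ 16`.  With file VIII-b (`≤ 16`) superseded, the `|Y| = 3` row of the `q = 3` cell now
reads `15 ≥ max |Z| ≥ ?`; the `(2,17)` witness (file D) shows the drop from `|Y| = 2` is real.

## Proof

`fact_row3f` assembles the five computational parts IX-a … IX-e (`native_decide`) into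
`repsC.all checkRep15`.  `checkCore15_sound` reads off the four alternatives of the root test;
`card_le15_of_one_mem3` then concludes in the standard model with `1 ∈ Z`: *dead* contradicts
`pairL (E 1) (w 1) = 4`; *four support-independent quotients* give an independent garbage family of
size four, so `|Z| + 4 + 1 ≤ 20` (`cap_fam_one`); the *triangular triple* and *two directions*
alternatives seed the recursive certificate, discharged by `nodeB_sound` of file X-a.  Conjugating
`y₂y₁⁻¹` into `repsC` (`fact_reps`), translating `Z` to contain `1`, and the model transport of
file V give the general statement.
-/

set_option linter.dupNamespace false

namespace Summit.MatrixMultiplication.MatrixMultiplication.Theorems.GradedDesignFamily.Negative.SubfieldNine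

open Matrix Module

/-! ### Assembling the five computational parts -/

/-- Splitting an `all` over `take`/`drop`. -/
theorem all_split {α : Type} {p : α → Bool} (l : List α) (n : ℕ) (h1 : (l.take n).all p = true)
    (h2 : (l.drop n).all p = true) : l.all p = true := by
  rw [← List.take_append_drop n l, List.all_append, h1, h2]; rfl

/-- **The β = 3 certificate holds for every class representative** (parts IX-a … IX-e). -/
theorem fact_row3f : repsC.all checkRep15 = true := by
  refine all_split repsC 148 fact_row3f1 (all_split _ 127 fact_row3f2 ?_)
  rw [List.drop_drop]
  refine all_split _ 125 fact_row3f3 ?_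
  rw [List.drop_drop]
  refine all_split _ 78 fact_row3f4 ?_
  rw [List.drop_drop]
  exact fact_row3f5

/-! ### Soundness of the root tests -/

/-- Soundness of `quadSearch`: four support-independent quotient codes. -/
theorem quadSearch_sound {W : ℕ → MC} {S : Array ℕ} (h : quadSearch W S = true) :
    ∃ ku kv kx ky : ℕ, dki (W ku) ≠ dki (W kv) ∧
      (∃ i, (vcN (W kx) i).isSome ∧ vcN (W ku) i = none ∧ vcN (W kv) i = none) ∧
      ∃ i, (vcN (W ky) i).isSome ∧ vcN (W ku) i = none ∧ vcN (W kv) i = none ∧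
        vcN (W kx) i = none := by
  simp only [quadSearch, List.any_eq_true, Bool.and_eq_true, bne_iff_ne, ne_eq, triAt, quadAt,
    Option.isNone_iff_eq_none] at h
  obtain ⟨uv, -, hne, ix, -, -, iy, -, ⟨-, ⟨hx, hu⟩, hv⟩, ⟨⟨hy, hu'⟩, hv'⟩, hx'⟩ := h
  exact ⟨uv.1, uv.2, ix, iy, hne, ⟨_, hx, hu, hv⟩, _, hy, hu', hv', hx'⟩

/-- The alternatives of a successful `checkCore15`, over the function `W` of the six quotient codes:
dead, four support-independent codes, a support-triangular triple with the recursive certificate,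
or two directions with the recursive certificate. -/
theorem checkCore15_sound {ac ai bc : MC} (h : checkCore15 ac ai bc = true) :
    ∃ W : ℕ → MC, W = sixF ac ai bc (invT bc) (mulT ac (invT bc)) (mulT bc ai) ∧
    ((∃ k < 6, dki (W k) = dki oneC) ∨
     (∃ ku kv kx ky : ℕ, dki (W ku) ≠ dki (W kv) ∧
       (∃ i, (vcN (W kx) i).isSome ∧ vcN (W ku) i = none ∧ vcN (W kv) i = none) ∧
       ∃ i, (vcN (W ky) i).isSome ∧ vcN (W ku) i = none ∧ vcN (W kv) i = none ∧
         vcN (W kx) i = none) ∨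
     (∃ ku kv kx : ℕ, dki (W ku) ≠ dki (W kv) ∧
       (∃ i, (vcN (W kx) i).isSome ∧ vcN (W ku) i = none ∧ vcN (W kv) i = none) ∧
       nodeB W 4 [W kx, W ku, W kv] = true) ∨
     (∃ ku kv : ℕ, dki (W ku) ≠ dki (W kv) ∧ nodeB W 4 [W ku, W kv] = true)) := by
  refine ⟨_, rfl, ?_⟩
  simp only [checkCore15, Bool.or_eq_true, List.any_eq_true, List.mem_range, beq_iff_eq] at h
  generalize sixF ac ai bc (invT bc) (mulT ac (invT bc)) (mulT bc ai) = W at h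
  generalize (#[sp ac, sp ai, sp bc, sp (invT bc), sp (mulT ac (invT bc)), sp (mulT bc ai)] :
    Array ℕ) = S at h
  rcases h with ⟨k, hk, hd⟩ | hq | hm
  · exact Or.inl ⟨k, hk, hd⟩
  · exact Or.inr (Or.inl (quadSearch_sound hq))
  · rcases htf : triFind W S with _ | ⟨ku, kv, kx, p⟩
    · rw [htf] at hm
      rcases htw : twoFind W with _ | ⟨ku, kv⟩
      · rw [htw] at hm; exact absurd hm Bool.false_ne_true
      · rw [htw] at hm
        simp only [Bool.and_eq_true, bne_iff_ne, ne_eq] at hm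
        exact Or.inr (Or.inr (Or.inr ⟨ku, kv, hm.1, hm.2⟩))
    · rw [htf] at hm
      simp only [triV, triAt, Bool.and_eq_true, bne_iff_ne, ne_eq, Option.isNone_iff_eq_none] at hm
      obtain ⟨⟨hne, ⟨hx, hu⟩, hv⟩, hnode⟩ := hm
      exact Or.inr (Or.inr (Or.inl ⟨ku, kv, kx, hne, ⟨_, hx, hu, hv⟩, hnode⟩))

/-! ### The main lemma -/

/-- **Main lemma (β = 3).** With `1 ∈ Z`, three distinct elements of `Y` and `y₂y₁⁻¹` a class
representative: `|Z| ≤ 15`. -/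
theorem card_le15_of_one_mem3 {Y Z : Finset (GL (Fin 2) K)} (hsep : IsSep Y Z)
    {y₁ y₂ y₃ : GL (Fin 2) K} (hy₁ : y₁ ∈ Y) (hy₂ : y₂ ∈ Y) (hy₃ : y₃ ∈ Y) (h12 : y₁ ≠ y₂)
    (h13 : y₁ ≠ y₃) (h23 : y₂ ≠ y₃) (hrep : mc ((y₂ * y₁⁻¹ : GL (Fin 2) K) : Mat) ∈ repsC)
    (h1 : (1 : GL (Fin 2) K) ∈ Z) : Z.card ≤ 15 := by
  classical
  choose cf hcf using hsep
  let Zs := {z // z ∈ Z}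
  -- pairing facts
  have PQ : ∀ (z₀ : Zs), ∀ y ∈ Y, ∀ y' ∈ Y, y ≠ y' → ∀ z ∈ Z,
      pairL (Edual (cf z₀ z₀.2)) (w ((y * y'⁻¹ * z : GL (Fin 2) K) : Mat)) = 0 := by
    intro z₀ y hy y' hy' hne z hz
    rw [pairL_w, Theta]
    have : ∀ h : SL3, ∑ x : Vec, cf z₀ z₀.2 x ((phiM h * ((y * y'⁻¹ * z : GL (Fin 2) K) : Mat)) *ᵥ
        x) = 0 := by
      intro h
      have e := hcf z₀ z₀.2 h y hy y' hy' z hz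
      rw [coe_conj, ← Units.val_mul] at e
      rw [e, if_neg]
      rintro ⟨-, h', -⟩; exact hne h'
    simp only [this, mul_zero, Finset.sum_const_zero]
  have P3 : ∀ z₀ z : Zs, pairL (Edual (cf z₀ z₀.2)) (w ((z : GL (Fin 2) K) : Mat)) =
      if z = z₀ then 4 else 0 := by
    intro z₀ z
    rw [pairL_w, Theta]
    have : ∀ h : SL3, ∑ x : Vec, cf z₀ z₀.2 x ((phiM h * ((z : GL (Fin 2) K) : Mat)) *ᵥ x) =
        if h = 1 then (if (z : GL (Fin 2) K) = z₀ then 1 else 0) else 0 := by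
      intro h
      have e := hcf z₀ z₀.2 h y₁ hy₁ y₁ hy₁ z z.2
      rw [mul_inv_cancel_right, Units.val_mul, ← phiM_eq] at e
      rw [e]; simp only [true_and, ite_and]
    simp only [this, mul_ite, mul_one, mul_zero, Finset.sum_ite_eq', Finset.mem_univ, kexp_one,
      cval, if_pos, σ_two, Subtype.coe_inj]
    split_ifs <;> norm_num
  set a : GL (Fin 2) K := y₂ * y₁⁻¹ with ha
  set b : GL (Fin 2) K := y₃ * y₁⁻¹ with hb
  have hquot : ∀ k, ∃ y ∈ Y, ∃ y' ∈ Y, y ≠ y' ∧ sixG a b k = y * y'⁻¹ := by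
    intro k
    match k with
    | 0 => exact ⟨y₂, hy₂, y₁, hy₁, h12.symm, rfl⟩
    | 1 => exact ⟨y₁, hy₁, y₂, hy₂, h12, by show a⁻¹ = _; rw [ha, _root_.mul_inv_rev, inv_inv]⟩
    | 2 => exact ⟨y₃, hy₃, y₁, hy₁, h13.symm, rfl⟩
    | 3 => exact ⟨y₁, hy₁, y₃, hy₃, h13, by show b⁻¹ = _; rw [hb, _root_.mul_inv_rev, inv_inv]⟩
    | 4 => exact ⟨y₂, hy₂, y₃, hy₃, h23, by show a * b⁻¹ = _; rw [ha, hb]; group⟩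
    | _ + 5 => exact ⟨y₃, hy₃, y₂, hy₂, h23.symm, by show b * a⁻¹ = _; rw [ha, hb]; group⟩
  have PW : ∀ k (z₀ : Zs), ∀ z ∈ Z,
      pairL (Edual (cf z₀ z₀.2)) (w ((sixG a b k * z : GL (Fin 2) K) : Mat)) = 0 := by
    intro k z₀ z hz
    obtain ⟨y, hy, y', hy', hne, hk⟩ := hquot k
    rw [hk]; exact PQ z₀ y hy y' hy' hne z hz
  have PW1 : ∀ k (z₀ : Zs), pairL (Edual (cf z₀ z₀.2)) (w ((sixG a b k : GL (Fin 2) K) : Mat)) = 0 := by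
    intro k z₀; have := PW k z₀ 1 h1; rwa [mul_one] at this
  -- the quotient codes as garbage
  have hWdet : ∀ k, detC (Wc a b k) ≠ 0 := fun k => detC_mc _ (det2_coe_ne_zero _)
  have hWvc : ∀ k i, vc (ofMC (Wc a b k)) i = vcN (Wc a b k) i := fun k i => by
    rw [fact_vc, mc_ofMC]
  have hdetL : ∀ L : List ℕ, ∀ u ∈ L.map (Wc a b), detC u ≠ 0 := by
    intro L u hu; obtain ⟨k, -, rfl⟩ := List.mem_map.mp hu; exact hWdet k
  have hgarL : ∀ L : List ℕ, ∀ u ∈ L.map (Wc a b), ∀ z₀ : Zs,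
      pairL (Edual (cf z₀ z₀.2)) (w (ofMC u)) = 0 := by
    intro L u hu z₀; obtain ⟨k, -, rfl⟩ := List.mem_map.mp hu; rw [ofMC_Wc]; exact PW1 k z₀
  have hind2 : ∀ ku kv, dki (Wc a b ku) ≠ dki (Wc a b kv) →
      LinearIndependent ℂ (fam [Wc a b ku, Wc a b kv]) := by
    intro ku kv hne
    have e : fam [Wc a b ku, Wc a b kv] = ![w ((sixG a b ku : GL (Fin 2) K) : Mat),
        w ((sixG a b kv : GL (Fin 2) K) : Mat)] := by
      funext j; fin_cases j <;> simp [fam, ofMC_Wc]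
    rw [e]
    refine linIndep_pair (fun c hc => hne ?_) (w_ne_zero _)
    have hk := kprop_of_smul hc
    rw [vc_eq, vc_eq] at hk
    exact dki_eq_of_kprop (hWdet ku) (hWdet kv) hk
  have hcons : ∀ (B : List MC) (kx : ℕ) (i : Idx), LinearIndependent ℂ (fam B) →
      (∀ u ∈ B, vc (ofMC u) i = none) → vcN (Wc a b kx) i ≠ none →
      LinearIndependent ℂ (fam (Wc a b kx :: B)) := by
    intro B kx i hB h0 hx
    refine fam_cons_indep hB (Pi.single i 1) (fun u hu => ?_) ?_
    · rw [pairL_single]; exact w_eq_zero_of_vc (h0 u hu)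
    · rw [pairL_single]; exact w_ne_zero_of_vc (by rw [hWvc]; exact hx)
  have hvan2 : ∀ ku kv (i : Idx), vcN (Wc a b ku) i = none → vcN (Wc a b kv) i = none →
      ∀ u ∈ [Wc a b ku, Wc a b kv], vc (ofMC u) i = none := by
    intro ku kv i hu hv u hu'
    simp only [List.mem_cons, List.not_mem_nil, or_false] at hu'
    rcases hu' with h | h <;> rw [h, hWvc] <;> assumption
  -- the certificate
  have hck : checkCore15 (mc (a : Mat)) (invT (mc (a : Mat))) (mc (b : Mat)) = true := by
    have := List.all_eq_true.mp fact_row3f _ hrep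
    simp only [checkRep15, List.all_eq_true, Bool.or_eq_true, beq_iff_eq] at this
    exact (this _ (mem_allMC (mc (b : Mat)))).resolve_left (detC_mc _ (det2_coe_ne_zero b))
  have hWf : sixF (mc (a : Mat)) (invT (mc (a : Mat))) (mc (b : Mat)) (invT (mc (b : Mat)))
      (mulT (mc (a : Mat)) (invT (mc (b : Mat)))) (mulT (mc (b : Mat)) (invT (mc (a : Mat)))) =
      Wc a b := funext fun k => by
    rw [sixF_mc (det2_coe_ne_zero a) (det2_coe_ne_zero b), Wc, coe_sixG]
  obtain ⟨W, hW, halt⟩ := checkCore15_sound hck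
  rw [hWf] at hW
  subst hW
  rcases halt with ⟨k, -, hd⟩ | ⟨ku, kv, kx, ky, hne, ⟨i, hx, hu, hv⟩, i', hy, hu', hv', hx'⟩ |
      ⟨ku, kv, kx, hne, ⟨i, hx, hu, hv⟩, hnode⟩ | ⟨ku, kv, hne, hnode⟩
  · -- dead
    exfalso
    have hk : kprop (vc ((sixG a b k : GL (Fin 2) K) : Mat)) (vc (1 : Mat)) := by
      rw [vc_eq, vc_eq, mc_one]
      exact kprop_of_dki (hWdet k) (by rw [← mc_one]; exact detC_mc 1 det2_one) hd
    obtain ⟨c, hc0, hc⟩ := w_smul_of_kprop hk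
    have h0 := PW1 k ⟨1, h1⟩
    rw [hc, map_smul, smul_eq_mul] at h0
    have h4 := P3 ⟨1, h1⟩ ⟨1, h1⟩
    rw [if_pos rfl] at h4
    rw [show (((⟨1, h1⟩ : Zs) : GL (Fin 2) K) : Mat) = (1 : Mat) from Units.val_one] at h4
    rw [h4] at h0
    exact hc0 (by simpa using h0)
  · -- four support-independent quotients
    have hB3 := hcons _ kx i (hind2 ku kv hne) (hvan2 ku kv i hu hv)
      (Option.ne_none_iff_isSome.mpr hx)
    have hB4 := hcons _ ky i' hB3 (fun u hu'' => by
        rcases List.mem_cons.mp hu'' with h | h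
        · rw [h, hWvc]; exact hx'
        · exact hvan2 ku kv i' hu' hv' u h)
      (Option.ne_none_iff_isSome.mpr hy)
    have := cap_fam_one (fun z₀ : Zs => Edual (cf z₀ z₀.2)) P3 (hdetL [ky, kx, ku, kv]) hB4
      (hgarL [ky, kx, ku, kv])
    simp only [List.length_cons, List.length_nil, List.length_map] at this
    omega
  · -- support-triangular triple, then the recursive certificate
    have hB3 := hcons _ kx i (hind2 ku kv hne) (hvan2 ku kv i hu hv)
      (Option.ne_none_iff_isSome.mpr hx)
    exact nodeB_sound (fun z₀ : Zs => Edual (cf z₀ z₀.2)) P3 a b PW 4 _ hnode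
      (hdetL [kx, ku, kv]) hB3 (hgarL [kx, ku, kv])
  · -- two directions, then the recursive certificate
    exact nodeB_sound (fun z₀ : Zs => Edual (cf z₀ z₀.2)) P3 a b PW 4 _ hnode
      (hdetL [ku, kv]) (hind2 ku kv hne) (hgarL [ku, kv])

/-- **Row `|Y| ≥ 3` of the `q = 3` subfield cell at β = 3, standard model:** a level-one separated
pair `(Y, Z)` with `|Y| ≥ 3` has `|Z| ≤ 15`. -/
theorem isSep_card_le_three15 (Y Z : Finset (GL (Fin 2) K)) (hsep : IsSep Y Z) (hY : 3 ≤ Y.card) :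
    Z.card ≤ 15 := by
  classical
  obtain ⟨y₁, hy₁, y₂, hy₂, y₃, hy₃, h12, h13, h23⟩ := Finset.two_lt_card.mp hY
  rcases Z.eq_empty_or_nonempty with rfl | ⟨z₁, hz₁⟩
  · simp
  have hne1 : ((y₂ * y₁⁻¹ : GL (Fin 2) K) : Mat) ≠ 1 := by
    intro h
    apply h12
    have : y₂ * y₁⁻¹ = 1 := Units.ext (by rw [h, Units.val_one])
    exact (mul_inv_eq_one.mp this).symm
  obtain ⟨g, hg⟩ := fact_reps _ (det2_coe_ne_zero _) hne1
  have hsep' := (hsep.conj g).translate (SpecialLinearGroup.mapGL K g * z₁)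
  set G : GL (Fin 2) K := SpecialLinearGroup.mapGL K g with hG
  have h1 : (1 : GL (Fin 2) K) ∈ (Z.image fun z => G * z).image (· * (G * z₁)⁻¹) :=
    Finset.mem_image.mpr ⟨G * z₁, Finset.mem_image.mpr ⟨z₁, hz₁, rfl⟩, mul_inv_cancel _⟩
  have hyi : ∀ y ∈ Y, G * y * G⁻¹ ∈ Y.image fun y => G * y * G⁻¹ :=
    fun y hy => Finset.mem_image.mpr ⟨y, hy, rfl⟩
  have hinj : Function.Injective fun y : GL (Fin 2) K => G * y * G⁻¹ := by
    intro y y' h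
    have h' : G * y * G⁻¹ = G * y' * G⁻¹ := h
    rwa [mul_left_inj, mul_right_inj] at h'
  have hrep : mc (((G * y₂ * G⁻¹) * (G * y₁ * G⁻¹)⁻¹ : GL (Fin 2) K) : Mat) ∈ repsC := by
    have e : (G * y₂ * G⁻¹) * (G * y₁ * G⁻¹)⁻¹ = G * (y₂ * y₁⁻¹) * G⁻¹ := by group
    have eGi : G⁻¹ = SpecialLinearGroup.mapGL K g⁻¹ := by rw [hG, map_inv]
    rw [e, Units.val_mul, Units.val_mul, eGi, hG, ← phiM_eq, ← phiM_eq, ← mul2_eq, ← mul2_eq]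
    exact hg
  have := card_le15_of_one_mem3 hsep' (hyi y₁ hy₁) (hyi y₂ hy₂) (hyi y₃ hy₃) (hinj.ne h12)
    (hinj.ne h13) (hinj.ne h23) hrep h1
  rwa [Finset.card_image_of_injective _ (mul_left_injective _),
    Finset.card_image_of_injective _ (mul_right_injective G)] at this

/-- The `(3,16)` instance of the standard-model `q = 3` subfield cell is FALSE. -/
theorem subfieldCell_nine_std_no_3x16 :
    ¬ ∃ Y Z : Finset (GL (Fin 2) K), 3 ≤ Y.card ∧ 16 ≤ Z.card ∧ IsSep Y Z := by
  rintro ⟨Y, Z, hY, hZ, hsep⟩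
  have := isSep_card_le_three15 Y Z hsep hY
  omega

/-- **Row `|Y| ≥ 3` of the `q = 3` cell at β = 3, in full generality:** for all `(k, K, φ)` with
`|k| = 3`, `|K| = |k|²`, `φ : SL₂(k) ↪ GL₂(K)`, every level-one separated pair `(Y, Z)` (S3's clause
verbatim) with `|Y| ≥ 3` has `|Z| ≤ 15`.  Finite-cell verdict, not summit progress. -/
theorem subfieldCell_nine_rowThree15 {k K' : Type} [Field k] [Fintype k] [DecidableEq k] [Field K']
    [Fintype K'] [DecidableEq K'] (hk : Fintype.card k = 3)
    (φ : Matrix.SpecialLinearGroup (Fin 2) k →* Matrix.GeneralLinearGroup (Fin 2) K')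
    (hφ : Function.Injective φ) (hK : Fintype.card K' = Fintype.card k ^ 2)
    (Y Z : Finset (Matrix.GeneralLinearGroup (Fin 2) K'))
    (hsep : ∀ z₀ ∈ Z, ∃ cf : (Fin 2 → K') → (Fin 2 → K') → ℂ,
      ∀ a : Matrix.SpecialLinearGroup (Fin 2) k, ∀ y ∈ Y, ∀ y' ∈ Y, ∀ z ∈ Z,
        (∑ u : Fin 2 → K', cf u (((φ a * y * y'⁻¹ * z : Matrix.GeneralLinearGroup (Fin 2) K') :
            Matrix (Fin 2) (Fin 2) K').mulVec u)) =
          if a = 1 ∧ y = y' ∧ z = z₀ then 1 else 0)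
    (hY : 3 ≤ Y.card) : Z.card ≤ 15 := by
  obtain ⟨Y', Z', hY', hZ', hsep'⟩ := isSep_transport hk φ hφ hK Y Z hsep
  have := isSep_card_le_three15 Y' Z' hsep' (by omega)
  omega

/-- The `(3,16)` instance of the `q = 3` subfield cell is FALSE for every `(k, K, φ)`; together
with the `(2,17)` witness (file D) and `|Y| ≤ 2 ⇒` rows (files III, V) this closes the `|Y| = 3`
row of the `q = 3` cell exactly: `max |Z| ∈ {.., 15}` for `|Y| = 3` is attained iff the `(3,15)`
instance holds (open). -/
theorem subfieldCell_nine_no_3x16 {k K' : Type} [Field k] [Fintype k] [DecidableEq k] [Field K']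
    [Fintype K'] [DecidableEq K'] (hk : Fintype.card k = 3)
    (φ : Matrix.SpecialLinearGroup (Fin 2) k →* Matrix.GeneralLinearGroup (Fin 2) K')
    (hφ : Function.Injective φ) (hK : Fintype.card K' = Fintype.card k ^ 2) :
    ¬ ∃ Y Z : Finset (Matrix.GeneralLinearGroup (Fin 2) K'), 3 ≤ Y.card ∧ 16 ≤ Z.card ∧
      ∀ z₀ ∈ Z, ∃ cf : (Fin 2 → K') → (Fin 2 → K') → ℂ,
        ∀ a : Matrix.SpecialLinearGroup (Fin 2) k, ∀ y ∈ Y, ∀ y' ∈ Y, ∀ z ∈ Z,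
          (∑ u : Fin 2 → K', cf u (((φ a * y * y'⁻¹ * z : Matrix.GeneralLinearGroup (Fin 2) K') :
              Matrix (Fin 2) (Fin 2) K').mulVec u)) =
            if a = 1 ∧ y = y' ∧ z = z₀ then 1 else 0 := by
  rintro ⟨Y, Z, hY, hZ, hsep⟩
  have := subfieldCell_nine_rowThree15 hk φ hφ hK Y Z hsep hY
  omega

end Summit.MatrixMultiplication.MatrixMultiplication.Theorems.GradedDesignFamily.Negative.SubfieldNine
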